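import Literature.NumberTheory.LFunctions.MauduitRivatLargeSieve
import HarnessLib

/-!
# Preliminaries for Mauduit–Rivat's type-I estimate: gcd regrouping and the large-sieve step (41)–(44) (proved)

Everything in this file is PROVED. In the proof of C. Mauduit, J. Rivat, *Prime numbers along
Rudin–Shapiro sequences*, J. Eur. Math. Soc. 17 (2015), Prop. 1, the quantity
`S_I'(ϑ') = ∑_{M/q<m≤M} m⁻¹ ∑_{0≤k<m} |G(ϑ' − k q^{μ+ν}/m)|` is treated ((38)–(44), pp. 2607–2610)
by grouping the pairs `(k, m)` according to `d = (k, m)`, `k = dk'`, `m = dm'`, and applying to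
each `d` the Cauchy–Schwarz inequality
`∑_{m'} ∑_{(k',m')=1} 1/m' |·| ≤ (∑∑ m'⁻²)^{1/2} (∑∑ |·|²)^{1/2}`, `∑∑ m'⁻² ≪ log`, (41), followed by
the large sieve inequality (23) for the trigonometric polynomial `u ↦ c(u) e(uk'/m')`. We prove
these two steps for coefficients in a complex inner product space `E` (Müllner's matrix-valued
setting, Duke Math. J. 166 (2017), Prop. 5.4):

* `sum_inv_sum_range_le_regroup` — for `Y ≥ 0` depending on `k/m` only,
  `∑_{m∈Ms} m⁻¹ ∑_{k<m} Y(k/m) ≤ ∑_{d≤M} d⁻¹ ∑_{m'≤M/d} m'⁻¹ ∑_{k'<m',(k',m')=1} Y(k'/m')`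
  (`Ms ⊆ [1, M]`);
* `sum_inv_sum_coprime_norm_le` — (41) + (23):
  `∑_{m'≤Q} m'⁻¹ ∑_{(k',m')=1} ‖∑_{u<N} e(k'u/m') • z u‖ ≤ (1 + log Q)^{1/2} ((N+1+2Q²) ∑‖z u‖²)^{1/2}`;
* small helpers: `Ioc_neg_one_eq_map`, `largeSieve_range`.

## References
* C. Mauduit, J. Rivat, J. Eur. Math. Soc. 17 (2015), proof of Prop. 1, (33), (38)–(44).
  [MauduitRivat2015]
* C. Müllner, Duke Math. J. 166 (2017), Prop. 5.4 (arXiv:1602.03042, pp. 26–27). [Mullner2017]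
-/

noncomputable section

open Finset Complex
open scoped FourierTransform

namespace Literature.NumberTheory.LFunctions.MauduitRivat

/-! ## Small helpers -/

/-- `(−1, −1 + N] ∩ ℤ` is the image of `{0, …, N − 1}`. [folklore] -/
theorem Ioc_neg_one_eq_map (N : ℕ) :
    Ioc (-1 : ℤ) (-1 + N) = (range N).map Nat.castEmbedding := by
  ext x
  simp only [mem_Ioc, mem_map, mem_range, Nat.castEmbedding_apply]
  constructor
  · rintro ⟨h1, h2⟩
    have hx : 0 ≤ x := by omega
    refine ⟨x.toNat, ?_, Int.toNat_of_nonneg hx⟩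
    have : x < (N : ℤ) := by omega
    exact (Int.toNat_lt hx).2 this
  · rintro ⟨u, hu, rfl⟩
    constructor <;> omega

/-! ## Grouping `k < m` by `d = gcd(k, m)` -/

/-- The fibre of `k ↦ gcd(k, m)` over a divisor `d` of `m ≥ 1` is `{d k' : k' < m/d, (k', m/d) = 1}`.
[folklore] -/
theorem filter_gcd_eq_image {m d : ℕ} (hm : 0 < m) (hd : d ∣ m) :
    (range m).filter (fun k => Nat.gcd k m = d) =
      ((range (m / d)).filter (fun k' => k'.Coprime (m / d))).image (fun k' => d * k') := by
  have hd0 : 0 < d := Nat.pos_of_dvd_of_pos hd hm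
  obtain ⟨e, he⟩ := hd
  have he0 : 0 < e := by
    rcases Nat.eq_zero_or_pos e with h | h
    · rw [h, mul_zero] at he; omega
    · exact h
  have hmd : m / d = e := by rw [he, Nat.mul_div_cancel_left _ hd0]
  ext k
  simp only [mem_filter, mem_range, mem_image]
  constructor
  · rintro ⟨hk, hg⟩
    have hdk : d ∣ k := hg ▸ Nat.gcd_dvd_left k m
    obtain ⟨k', rfl⟩ := hdk
    refine ⟨k', ⟨?_, ?_⟩, rfl⟩
    · rw [hmd]
      rw [he] at hk
      exact Nat.lt_of_mul_lt_mul_left hk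
    · rw [hmd]
      have h2 : Nat.gcd (d * k') (d * e) = d * Nat.gcd k' e := Nat.gcd_mul_left d k' e
      rw [← he, hg] at h2
      have : Nat.gcd k' e = 1 := by
        have h3 : d * Nat.gcd k' e = d * 1 := by rw [mul_one]; exact h2.symm
        exact Nat.eq_of_mul_eq_mul_left hd0 h3
      exact this
  · rintro ⟨k', ⟨hk', hcop⟩, rfl⟩
    rw [hmd] at hk' hcop
    refine ⟨?_, ?_⟩
    · rw [he]; exact Nat.mul_lt_mul_of_pos_left hk' hd0
    · rw [he, Nat.gcd_mul_left, Nat.Coprime.gcd_eq_one hcop, mul_one]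

/-- **Grouping by the gcd**: for `m ≥ 1` and `Y : ℝ → ℝ`,
`∑_{k<m} Y(k/m) = ∑_{d ∣ m} ∑_{k'<m/d, (k',m/d)=1} Y(k'/(m/d))`. [folklore] -/
theorem sum_range_eq_sum_divisors_coprime {m : ℕ} (hm : 0 < m) (Y : ℝ → ℝ) :
    ∑ k ∈ range m, Y ((k : ℝ) / m) =
      ∑ d ∈ m.divisors, ∑ k' ∈ (range (m / d)).filter (fun k' => k'.Coprime (m / d)),
        Y ((k' : ℝ) / ((m / d : ℕ) : ℝ)) := by
  rw [← sum_fiberwise_of_maps_to (s := range m) (t := m.divisors) (g := fun k => Nat.gcd k m)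
    (fun k _ => Nat.mem_divisors.2 ⟨Nat.gcd_dvd_right k m, hm.ne'⟩)]
  refine sum_congr rfl fun d hd => ?_
  have hdm : d ∣ m := Nat.dvd_of_mem_divisors hd
  have hd0 : 0 < d := Nat.pos_of_dvd_of_pos hdm hm
  rw [filter_gcd_eq_image hm hdm, sum_image]
  · refine sum_congr rfl fun k' _ => ?_
    congr 1
    rw [Nat.cast_div hdm (by exact_mod_cast hd0.ne'), Nat.cast_mul]
    field_simp
  · intro a _ b _ hab
    exact Nat.eq_of_mul_eq_mul_left hd0 hab

/-- The divisors of `m ∈ [1, M]` are the `d ∈ [1, M]` dividing `m`. [folklore] -/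
theorem divisors_eq_filter_Icc {m M : ℕ} (hm : 0 < m) (hmM : m ≤ M) :
    m.divisors = (Icc 1 M).filter (fun d => d ∣ m) := by
  ext d
  simp only [Nat.mem_divisors, mem_filter, mem_Icc]
  constructor
  · rintro ⟨hd, -⟩
    exact ⟨⟨Nat.pos_of_dvd_of_pos hd hm, (Nat.le_of_dvd hm hd).trans hmM⟩, hd⟩
  · rintro ⟨-, hd⟩
    exact ⟨hd, hm.ne'⟩

/-- **Mauduit–Rivat's regrouping by `d = (k, m)`** (the display before (38)): for `Ms ⊆ [1, M]`
and `Y ≥ 0`,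
`∑_{m∈Ms} m⁻¹ ∑_{k<m} Y(k/m) ≤ ∑_{d≤M} d⁻¹ ∑_{m'≤M/d} m'⁻¹ ∑_{k'<m',(k',m')=1} Y(k'/m')`.
[cite: MauduitRivat2015, Prop. 1 (proof, before (38))] -/
theorem sum_inv_sum_range_le_regroup {Ms : Finset ℕ} {M : ℕ} (hMs : Ms ⊆ Icc 1 M) (Y : ℝ → ℝ)
    (hY : ∀ x, 0 ≤ Y x) :
    ∑ m ∈ Ms, (m : ℝ)⁻¹ * ∑ k ∈ range m, Y ((k : ℝ) / m) ≤
      ∑ d ∈ Icc 1 M, (d : ℝ)⁻¹ * ∑ m' ∈ Icc 1 (M / d), (m' : ℝ)⁻¹ *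
        ∑ k' ∈ (range m').filter (fun k' => k'.Coprime m'), Y ((k' : ℝ) / m') := by
  -- notation for the coprime sum
  set I : ℕ → ℝ := fun m' => ∑ k' ∈ (range m').filter (fun k' => k'.Coprime m'), Y ((k' : ℝ) / m')
    with hI
  have hI0 : ∀ m', 0 ≤ I m' := fun m' => sum_nonneg fun _ _ => hY _
  -- Step 1: regroup each `m`
  have h1 : ∀ m ∈ Ms, (m : ℝ)⁻¹ * ∑ k ∈ range m, Y ((k : ℝ) / m) =
      ∑ d ∈ Icc 1 M, if d ∣ m then (m : ℝ)⁻¹ * I (m / d) else 0 := by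
    intro m hm
    have hm' := mem_Icc.1 (hMs hm)
    rw [sum_range_eq_sum_divisors_coprime (by omega) Y, mul_sum, ← sum_filter,
      ← divisors_eq_filter_Icc (by omega) hm'.2]
  rw [sum_congr rfl h1, sum_comm]
  refine sum_le_sum fun d hd => ?_
  have hd' := mem_Icc.1 hd
  have hd0 : 0 < d := by omega
  rw [← sum_filter]
  -- Step 2: reindex `m = d m'`
  have hinj : Set.InjOn (fun m => m / d) ↑(Ms.filter (fun m => d ∣ m)) := by
    intro a ha b hb hab
    simp only [coe_filter, Set.mem_setOf_eq] at ha hb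
    calc a = a / d * d := (Nat.div_mul_cancel ha.2).symm
      _ = b / d * d := by rw [show a / d = b / d from hab]
      _ = b := Nat.div_mul_cancel hb.2
  have h2 : ∑ m ∈ Ms.filter (fun m => d ∣ m), (m : ℝ)⁻¹ * I (m / d) =
      ∑ m' ∈ (Ms.filter (fun m => d ∣ m)).image (fun m => m / d), ((d : ℝ) * m')⁻¹ * I m' := by
    rw [sum_image hinj]
    refine sum_congr rfl fun m hm => ?_
    have hdm : d ∣ m := (mem_filter.1 hm).2
    congr 2
    rw [Nat.cast_div hdm (by exact_mod_cast hd0.ne')]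
    field_simp
  rw [h2, mul_sum]
  have hsub : (Ms.filter (fun m => d ∣ m)).image (fun m => m / d) ⊆ Icc 1 (M / d) := by
    intro m' hm'
    simp only [mem_image, mem_filter] at hm'
    obtain ⟨m, ⟨hm, hdm⟩, rfl⟩ := hm'
    have hm' := mem_Icc.1 (hMs hm)
    rw [mem_Icc]
    exact ⟨(Nat.one_le_div_iff hd0).2 (Nat.le_of_dvd (by omega) hdm), Nat.div_le_div_right hm'.2⟩
  refine (sum_le_sum_of_subset_of_nonneg hsub fun m' _ _ => ?_).trans (le_of_eq ?_)
  · exact mul_nonneg (by positivity) (hI0 _)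
  · refine sum_congr rfl fun m' _ => ?_
    rw [mul_inv, mul_assoc]

/-! ## Cauchy–Schwarz and the large sieve: (41) and (23) -/

section Inner

variable {E : Type*} [NormedAddCommGroup E] [InnerProductSpace ℂ E]

/-- The large sieve for coefficients indexed by `u < N`. [cite: MauduitRivat2015, Lemma 6] -/
theorem largeSieve_range (z : ℕ → E) (N Q : ℕ) :
    ∑ m ∈ Icc 1 Q, ∑ k ∈ range m with k.Coprime m,
        ‖∑ u ∈ range N, (𝐞 ((k : ℝ) * u / m) : ℂ) • z u‖ ^ 2 ≤
      ((N : ℝ) + 1 + 2 * (Q : ℝ) ^ 2) * ∑ u ∈ range N, ‖z u‖ ^ 2 := by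
  have h := largeSieve_farey_hilbert (fun n : ℤ => z n.toNat) (-1) N Q
  rw [Ioc_neg_one_eq_map] at h
  simp only [sum_map, Nat.castEmbedding_apply, Int.cast_natCast, Int.toNat_natCast] at h
  exact h

/-- **Mauduit–Rivat (41) + (23)**, vector-valued: for `z : ℕ → E` and `N, Q ∈ ℕ`,
`∑_{m≤Q} m⁻¹ ∑_{k<m,(k,m)=1} ‖∑_{u<N} e(ku/m) • z u‖ ≤ (1 + log Q)^{1/2} ((N+1+2Q²) ∑_{u<N} ‖z u‖²)^{1/2}`.
[cite: MauduitRivat2015, (41) and (23)] -/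
theorem sum_inv_sum_coprime_norm_le (z : ℕ → E) (N Q : ℕ) :
    ∑ m ∈ Icc 1 Q, (m : ℝ)⁻¹ * ∑ k ∈ (range m).filter (fun k => k.Coprime m),
        ‖∑ u ∈ range N, (𝐞 ((k : ℝ) * u / m) : ℂ) • z u‖ ≤
      Real.sqrt (1 + Real.log Q) *
        Real.sqrt (((N : ℝ) + 1 + 2 * (Q : ℝ) ^ 2) * ∑ u ∈ range N, ‖z u‖ ^ 2) := by
  -- the index set of pairs `(m, k)`
  set P : Finset ((_ : ℕ) × ℕ) := (Icc 1 Q).sigma fun m => (range m).filter fun k => k.Coprime m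
    with hP
  set T : ((_ : ℕ) × ℕ) → ℝ := fun p =>
    ‖∑ u ∈ range N, (𝐞 ((p.2 : ℝ) * u / p.1) : ℂ) • z u‖ with hT
  have hLHS : ∑ m ∈ Icc 1 Q, (m : ℝ)⁻¹ * ∑ k ∈ (range m).filter (fun k => k.Coprime m),
      ‖∑ u ∈ range N, (𝐞 ((k : ℝ) * u / m) : ℂ) • z u‖ = ∑ p ∈ P, (p.1 : ℝ)⁻¹ * T p := by
    rw [hP, sum_sigma]
    exact sum_congr rfl fun m _ => by rw [mul_sum]
  rw [hLHS]
  -- Cauchy–Schwarz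
  have hCS := sum_mul_sq_le_sq_mul_sq P (fun p => (p.1 : ℝ)⁻¹) T
  have hA : ∑ p ∈ P, ((p.1 : ℝ)⁻¹) ^ 2 ≤ 1 + Real.log Q := by
    rw [hP, sum_sigma]
    calc ∑ m ∈ Icc 1 Q, ∑ _k ∈ (range m).filter (fun k => k.Coprime m), ((m : ℝ)⁻¹) ^ 2
        ≤ ∑ m ∈ Icc 1 Q, (m : ℝ)⁻¹ := by
          refine sum_le_sum fun m hm => ?_
          have hm1 : (1 : ℝ) ≤ m := by exact_mod_cast (mem_Icc.1 hm).1
          rw [sum_const, nsmul_eq_mul]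
          have hcard : (((range m).filter (fun k => k.Coprime m)).card : ℝ) ≤ m := by
            have := (filter_subset (fun k => k.Coprime m) (range m)) |> card_le_card
            rw [card_range] at this
            exact_mod_cast this
          have hm0 : (0 : ℝ) < m := by linarith
          calc (((range m).filter (fun k => k.Coprime m)).card : ℝ) * ((m : ℝ)⁻¹) ^ 2
              ≤ m * ((m : ℝ)⁻¹) ^ 2 := by gcongr
            _ = (m : ℝ)⁻¹ := by field_simp
      _ ≤ 1 + Real.log Q := by
          have h := harmonic_le_one_add_log Q
          simpa [harmonic_eq_sum_Icc, Rat.cast_sum, Rat.cast_inv, Rat.cast_natCast] using h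
  have hB : ∑ p ∈ P, (T p) ^ 2 ≤ ((N : ℝ) + 1 + 2 * (Q : ℝ) ^ 2) * ∑ u ∈ range N, ‖z u‖ ^ 2 := by
    rw [hP, sum_sigma]
    exact largeSieve_range z N Q
  have hA0 : 0 ≤ ∑ p ∈ P, ((p.1 : ℝ)⁻¹) ^ 2 := sum_nonneg fun _ _ => sq_nonneg _
  calc ∑ p ∈ P, (p.1 : ℝ)⁻¹ * T p
      ≤ |∑ p ∈ P, (p.1 : ℝ)⁻¹ * T p| := le_abs_self _
    _ ≤ Real.sqrt ((∑ p ∈ P, ((p.1 : ℝ)⁻¹) ^ 2) * ∑ p ∈ P, (T p) ^ 2) := Real.abs_le_sqrt hCS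
    _ = Real.sqrt (∑ p ∈ P, ((p.1 : ℝ)⁻¹) ^ 2) * Real.sqrt (∑ p ∈ P, (T p) ^ 2) :=
        Real.sqrt_mul hA0 _
    _ ≤ Real.sqrt (1 + Real.log Q) *
        Real.sqrt (((N : ℝ) + 1 + 2 * (Q : ℝ) ^ 2) * ∑ u ∈ range N, ‖z u‖ ^ 2) := by
        gcongr

/-- The same with the phase written `e((k/m) u)`. [cite: MauduitRivat2015, (41) and (23)] -/
theorem sum_inv_sum_coprime_norm_le' (z : ℕ → E) (N Q : ℕ) :
    ∑ m ∈ Icc 1 Q, (m : ℝ)⁻¹ * ∑ k ∈ (range m).filter (fun k => k.Coprime m),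
        ‖∑ u ∈ range N, (𝐞 ((k : ℝ) / m * u) : ℂ) • z u‖ ≤
      Real.sqrt (1 + Real.log Q) *
        Real.sqrt (((N : ℝ) + 1 + 2 * (Q : ℝ) ^ 2) * ∑ u ∈ range N, ‖z u‖ ^ 2) := by
  refine le_of_eq_of_le ?_ (sum_inv_sum_coprime_norm_le z N Q)
  refine sum_congr rfl fun m _ => ?_
  congr 1
  refine sum_congr rfl fun k _ => ?_
  congr 1
  refine sum_congr rfl fun u _ => ?_
  rw [mul_comm_div, mul_div_assoc]

/-- **Cauchy–Schwarz for square roots**: `∑_{i∈s} √(a i) ≤ √(#s · ∑ a i)` (`a ≥ 0`). [folklore] -/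
theorem sum_sqrt_le_sqrt_card_mul {ι : Type*} (s : Finset ι) {a : ι → ℝ} (ha : ∀ i ∈ s, 0 ≤ a i) :
    ∑ i ∈ s, Real.sqrt (a i) ≤ Real.sqrt (s.card * ∑ i ∈ s, a i) := by
  have hCS := sum_mul_sq_le_sq_mul_sq s (fun _ => (1 : ℝ)) (fun i => Real.sqrt (a i))
  simp only [one_mul, one_pow, sum_const, nsmul_eq_mul, mul_one] at hCS
  have h2 : ∑ i ∈ s, Real.sqrt (a i) ^ 2 = ∑ i ∈ s, a i :=
    sum_congr rfl fun i hi => Real.sq_sqrt (ha i hi)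
  rw [h2] at hCS
  exact (le_abs_self _).trans (Real.abs_le_sqrt hCS)

end Inner

end Literature.NumberTheory.LFunctions.MauduitRivat
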